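import Mathlib.Analysis.Analytic.OfScalars
import Mathlib.Analysis.Analytic.Uniqueness
import Mathlib.Analysis.Analytic.ChangeOrigin
import Mathlib.Analysis.Analytic.Constructions
import Mathlib.Analysis.SpecialFunctions.Complex.Analytic
import Mathlib.Analysis.SpecialFunctions.ExpDeriv
import Mathlib.Analysis.SpecialFunctions.Pow.Real
import Mathlib.Topology.Algebra.InfiniteSum.Real
import Mathlib.Analysis.Normed.Group.InfiniteSum
import HarnessLib

/-!
# Real double power series on the unit square: separate analyticity, and the identity theorem on a
rectangle for separately analytic functions

Elementary real-analytic facts used by the radial-frame continuation of the typed 3D conformal blocks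
(`Literature.MathematicalPhysics.QuantumFieldTheory.ConformalBootstrap3D.BlockSignedRadialExpansion`): Hogervorst–Rychkov 2013 §3.1 continue a conformal block from the
`z`-disc to the `ρ`-disc; in the tree this is done one real variable at a time, and the only analytic
input is the classical one-variable theory of real power series (Field, *Essential Real Analysis*,
Springer 2017, §5.4: a power series with radius `R > 0` is analytic on `(-R, R)`, Prop. 5.4.3; two
analytic functions on an interval that agree on a non-empty open subinterval agree everywhere,
Cor. 5.4.11), which Mathlib provides (`FormalMultilinearSeries.ofScalars`,
`FormalMultilinearSeries.analyticOnNhd`, `AnalyticOnNhd.eqOn_of_preconnected_of_eventuallyEq`).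

* `analyticOnNhd_tsum_mul_pow` — `x ↦ Σ cₙ xⁿ` is real-analytic on `(-1,1)` when `Σ |cₙ| rⁿ < ∞` for
  every `0 ≤ r < 1`.
* `analyticOnNhd_tsum_prod_fst` / `_snd` — a double power series `Σ M(a,b) xᵃ yᵇ` absolutely convergent
  on the open unit square is, for each fixed value of one variable in `(-1,1)`, real-analytic in the
  other on `(-1,1)` (row sums are power series with radius `≥ 1`).
* `eqOn_of_separatelyAnalyticOn` — two functions on a square `I × I` (`I` an open interval), each
  real-analytic in each variable separately for every fixed value of the other in `I`, which agree on a
  sub-square `J × J` (`J ⊆ I` a non-empty open interval), agree on `I × I` (the one-variable identity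
  theorem applied twice; no joint analyticity is needed).
* `analyticAt_rpow_const_of_pos` — `t ↦ f(t)^α` is real-analytic where `f` is analytic and positive.

No definition and no named fact is introduced; in-file plumbing lemmas are `private`.

Sources: M. Field, *Essential Real Analysis*, Springer (2017), §5.4 Prop. 5.4.3, Cor. 5.4.11
(doi:10.1007/978-3-319-67546-6); M. Hogervorst, S. Rychkov, Phys. Rev. D 87 (2013) 106004,
arXiv:1303.1111, §3.1 (the use). Mathlib: `FormalMultilinearSeries.ofScalars`, `ofScalars_norm`,
`FormalMultilinearSeries.le_radius_of_summable`, `FormalMultilinearSeries.analyticOnNhd`,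
`AnalyticOnNhd.eqOn_of_preconnected_of_eventuallyEq`, `Summable.tsum_prod'`, `Summable.prod`,
`analyticAt_log`, `AnalyticAt.rexp'`.
-/

namespace Literature.Analysis.Calculus

open Set Filter Topology

/-! ### One-variable real power series on `(-1,1)` -/

/-- **A real power series with radius `≥ 1` is real-analytic on `(-1,1)`**: if `Σ |cₙ| rⁿ < ∞` for every
`0 ≤ r < 1`, then `x ↦ Σ cₙ xⁿ` is analytic at every point of `(-1,1)`.
[cite: Field2017, §5.4 Prop. 5.4.3] -/
theorem analyticOnNhd_tsum_mul_pow {c : ℕ → ℝ}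
    (hc : ∀ r : ℝ, 0 ≤ r → r < 1 → Summable fun n => |c n| * r ^ n) :
    AnalyticOnNhd ℝ (fun x : ℝ => ∑' n, c n * x ^ n) (Ioo (-1) 1) := by
  set p : FormalMultilinearSeries ℝ ℝ ℝ := FormalMultilinearSeries.ofScalars ℝ c with hp
  have hrad : (1 : ENNReal) ≤ p.radius := by
    refine ENNReal.le_of_forall_nnreal_lt fun r hr => ?_
    have hr' : (r : ℝ) < 1 := by exact_mod_cast hr
    refine p.le_radius_of_summable ?_
    refine (hc r r.2 hr').congr fun n => ?_
    rw [hp, FormalMultilinearSeries.ofScalars_norm, Real.norm_eq_abs]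
  have hsum : ∀ x : ℝ, p.sum x = ∑' n, c n * x ^ n := by
    intro x
    have h := FormalMultilinearSeries.ofScalars_sum_eq c x
    simp only [smul_eq_mul] at h
    exact h
  intro x hx
  have hxball : x ∈ Metric.eball (0 : ℝ) p.radius := by
    rw [Metric.mem_eball, edist_zero_right, ← ofReal_norm, Real.norm_eq_abs]
    exact lt_of_lt_of_le (ENNReal.ofReal_lt_one.2 (abs_lt.2 ⟨hx.1, hx.2⟩)) hrad
  have ha : AnalyticAt ℝ p.sum x := p.analyticOnNhd x hxball
  refine ha.congr (Filter.Eventually.of_forall fun y => hsum y)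

/-! ### Double power series on the unit square -/

/-- Absolute convergence on the open unit square gives convergence at every `|x|, |y| < 1`. [folklore] -/
private theorem summable_mul_pow_mul_pow_of_abs {M : ℕ × ℕ → ℝ}
    (hM : ∀ r t : ℝ, 0 ≤ r → r < 1 → 0 ≤ t → t < 1 →
      Summable fun p : ℕ × ℕ => |M p| * r ^ p.1 * t ^ p.2)
    {x y : ℝ} (hx : |x| < 1) (hy : |y| < 1) :
    Summable fun p : ℕ × ℕ => M p * x ^ p.1 * y ^ p.2 := by
  refine Summable.of_norm_bounded (hM |x| |y| (abs_nonneg x) hx (abs_nonneg y) hy) fun p => ?_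
  rw [Real.norm_eq_abs, abs_mul, abs_mul, abs_pow, abs_pow]

/-- Rows of an absolutely convergent double power series are absolutely summable: for `|y| < 1`,
`Σ_b |M(a,b)| |y|^b < ∞`. [folklore] -/
private theorem summable_row_abs {M : ℕ × ℕ → ℝ}
    (hM : ∀ r t : ℝ, 0 ≤ r → r < 1 → 0 ≤ t → t < 1 →
      Summable fun p : ℕ × ℕ => |M p| * r ^ p.1 * t ^ p.2)
    {y : ℝ} (hy : |y| < 1) (a : ℕ) : Summable fun b : ℕ => |M (a, b)| * |y| ^ b := by
  have h := (hM (1 / 2) |y| (by norm_num) (by norm_num) (abs_nonneg y) hy).prod_factor a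
  refine ((h.mul_left ((2 : ℝ) ^ a)).congr fun b => ?_)
  simp only
  rw [one_div, inv_pow]
  field_simp

/-- For `|x|, |y| < 1` the double series is the power series in `x` of its row sums:
`Σ_{(a,b)} M(a,b) xᵃ yᵇ = Σ_a (Σ_b M(a,b) yᵇ) xᵃ`. [folklore] -/
private theorem tsum_prod_eq_tsum_row {M : ℕ × ℕ → ℝ}
    (hM : ∀ r t : ℝ, 0 ≤ r → r < 1 → 0 ≤ t → t < 1 →
      Summable fun p : ℕ × ℕ => |M p| * r ^ p.1 * t ^ p.2)
    {x y : ℝ} (hx : |x| < 1) (hy : |y| < 1) :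
    ∑' p : ℕ × ℕ, M p * x ^ p.1 * y ^ p.2 = ∑' a, (∑' b, M (a, b) * y ^ b) * x ^ a := by
  have hs := summable_mul_pow_mul_pow_of_abs hM hx hy
  rw [hs.tsum_prod' (fun a => hs.prod_factor a)]
  refine tsum_congr fun a => ?_
  rw [← tsum_mul_right]
  exact tsum_congr fun b => by ring

/-- **Separate analyticity in the first variable.** For `|y| < 1` fixed, `x ↦ Σ M(a,b) xᵃ yᵇ` is
real-analytic on `(-1,1)`. [cite: Field2017, §5.4 Prop. 5.4.3] -/
theorem analyticOnNhd_tsum_prod_fst {M : ℕ × ℕ → ℝ}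
    (hM : ∀ r t : ℝ, 0 ≤ r → r < 1 → 0 ≤ t → t < 1 →
      Summable fun p : ℕ × ℕ => |M p| * r ^ p.1 * t ^ p.2)
    {y : ℝ} (hy : |y| < 1) :
    AnalyticOnNhd ℝ (fun x : ℝ => ∑' p : ℕ × ℕ, M p * x ^ p.1 * y ^ p.2) (Ioo (-1) 1) := by
  -- the row sums are the coefficients of a power series with radius `≥ 1`
  have hc : ∀ r : ℝ, 0 ≤ r → r < 1 →
      Summable fun a => |∑' b, M (a, b) * y ^ b| * r ^ a := by
    intro r hr0 hr1
    have h2 := hM r |y| hr0 hr1 (abs_nonneg y) hy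
    have hrow : Summable fun a => ∑' b, |M (a, b)| * r ^ a * |y| ^ b := h2.prod
    refine Summable.of_nonneg_of_le (fun a => by positivity) (fun a => ?_) hrow
    have hsb : Summable fun b => |M (a, b) * y ^ b| := by
      refine (summable_row_abs hM hy a).congr fun b => ?_
      rw [abs_mul, abs_pow]
    have h1 : |∑' b, M (a, b) * y ^ b| ≤ ∑' b, |M (a, b) * y ^ b| := by
      have := norm_tsum_le_tsum_norm (f := fun b => M (a, b) * y ^ b)
        (by simpa only [Real.norm_eq_abs] using hsb)
      simpa only [Real.norm_eq_abs] using this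
    calc |∑' b, M (a, b) * y ^ b| * r ^ a
        ≤ (∑' b, |M (a, b) * y ^ b|) * r ^ a :=
          mul_le_mul_of_nonneg_right h1 (pow_nonneg hr0 _)
      _ = ∑' b, |M (a, b)| * r ^ a * |y| ^ b := by
          rw [← tsum_mul_right]
          refine tsum_congr fun b => ?_
          rw [abs_mul, abs_pow]
          ring
  have hA := analyticOnNhd_tsum_mul_pow hc
  refine hA.congr isOpen_Ioo fun x hx => ?_
  exact (tsum_prod_eq_tsum_row hM (abs_lt.2 ⟨hx.1, hx.2⟩) hy).symm

/-- **Separate analyticity in the second variable.** For `|x| < 1` fixed, `y ↦ Σ M(a,b) xᵃ yᵇ` is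
real-analytic on `(-1,1)`. [cite: Field2017, §5.4 Prop. 5.4.3] -/
theorem analyticOnNhd_tsum_prod_snd {M : ℕ × ℕ → ℝ}
    (hM : ∀ r t : ℝ, 0 ≤ r → r < 1 → 0 ≤ t → t < 1 →
      Summable fun p : ℕ × ℕ => |M p| * r ^ p.1 * t ^ p.2)
    {x : ℝ} (hx : |x| < 1) :
    AnalyticOnNhd ℝ (fun y : ℝ => ∑' p : ℕ × ℕ, M p * x ^ p.1 * y ^ p.2) (Ioo (-1) 1) := by
  -- swap the variables
  have hM' : ∀ r t : ℝ, 0 ≤ r → r < 1 → 0 ≤ t → t < 1 →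
      Summable fun p : ℕ × ℕ => |M p.swap| * r ^ p.1 * t ^ p.2 := by
    intro r t hr0 hr1 ht0 ht1
    have h := (Equiv.prodComm ℕ ℕ).summable_iff.mpr (hM t r ht0 ht1 hr0 hr1)
    refine h.congr fun p => ?_
    simp only [Function.comp_apply, Equiv.prodComm_apply, Prod.fst_swap, Prod.snd_swap]
    ring
  have hA := analyticOnNhd_tsum_prod_fst hM' hx
  refine hA.congr isOpen_Ioo fun y _ => ?_
  show ∑' p : ℕ × ℕ, M p.swap * y ^ p.1 * x ^ p.2 = ∑' p : ℕ × ℕ, M p * x ^ p.1 * y ^ p.2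
  rw [← (Equiv.prodComm ℕ ℕ).tsum_eq (fun p : ℕ × ℕ => M p * x ^ p.1 * y ^ p.2)]
  refine tsum_congr fun p => ?_
  simp only [Equiv.prodComm_apply, Prod.fst_swap, Prod.snd_swap]
  ring

/-! ### The identity theorem on a square for separately analytic functions -/

/-- One-variable identity theorem on an open interval: two real-analytic functions on `(a,b)` that
agree on a non-empty open subinterval `(a',b') ⊆ (a,b)` agree on `(a,b)`.
[cite: Field2017, §5.4 Cor. 5.4.11] -/
theorem eqOn_Ioo_of_analyticOnNhd {f g : ℝ → ℝ} {a b a' b' : ℝ} (hsub : Ioo a' b' ⊆ Ioo a b)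
    (hne : a' < b') (hf : AnalyticOnNhd ℝ f (Ioo a b)) (hg : AnalyticOnNhd ℝ g (Ioo a b))
    (hfg : ∀ t ∈ Ioo a' b', f t = g t) : ∀ t ∈ Ioo a b, f t = g t := by
  intro t ht
  have hx₀' : (a' + b') / 2 ∈ Ioo a' b' := ⟨by linarith, by linarith⟩
  have hx₀ : (a' + b') / 2 ∈ Ioo a b := hsub hx₀'
  have hev : f =ᶠ[𝓝 ((a' + b') / 2)] g :=
    Filter.eventuallyEq_of_mem (Ioo_mem_nhds hx₀'.1 hx₀'.2) fun s hs => hfg s hs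
  exact hf.eqOn_of_preconnected_of_eventuallyEq hg isPreconnected_Ioo hx₀ hev ht

/-- **Identity theorem on a square for separately analytic functions.** Let `I = (a,b)` and let
`J = (a',b') ⊆ I` be non-empty. If `F, G : ℝ → ℝ → ℝ` are, for every fixed value of either variable in
`I`, real-analytic on `I` in the other variable, and `F = G` on `J × J`, then `F = G` on `I × I`
(apply the one-variable identity theorem in `x` at each `y ∈ J`, then in `y` at each `x ∈ I`).
[cite: Field2017, §5.4 Cor. 5.4.11] -/
theorem eqOn_of_separatelyAnalyticOn {F G : ℝ → ℝ → ℝ} {a b a' b' : ℝ}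
    (hsub : Ioo a' b' ⊆ Ioo a b) (hne : a' < b')
    (hF₁ : ∀ y ∈ Ioo a b, AnalyticOnNhd ℝ (fun x => F x y) (Ioo a b))
    (hG₁ : ∀ y ∈ Ioo a b, AnalyticOnNhd ℝ (fun x => G x y) (Ioo a b))
    (hF₂ : ∀ x ∈ Ioo a b, AnalyticOnNhd ℝ (fun y => F x y) (Ioo a b))
    (hG₂ : ∀ x ∈ Ioo a b, AnalyticOnNhd ℝ (fun y => G x y) (Ioo a b))
    (h : ∀ x ∈ Ioo a' b', ∀ y ∈ Ioo a' b', F x y = G x y) :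
    ∀ x ∈ Ioo a b, ∀ y ∈ Ioo a b, F x y = G x y := by
  have step1 : ∀ y ∈ Ioo a' b', ∀ x ∈ Ioo a b, F x y = G x y := fun y hy =>
    eqOn_Ioo_of_analyticOnNhd hsub hne (hF₁ y (hsub hy)) (hG₁ y (hsub hy)) fun x hx => h x hx y hy
  intro x hx y hy
  exact eqOn_Ioo_of_analyticOnNhd hsub hne (hF₂ x hx) (hG₂ x hx) (fun y' hy' => step1 y' hy' x hx) y hy

/-! ### Real powers of positive analytic functions -/

/-- `t ↦ f(t)^α` (`Real.rpow`, constant exponent) is real-analytic at a point where `f` is analytic and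
positive: near the point `f^α = exp(α log f)` is a composite of analytic functions (Field 2017
Prop. 5.4.6 (3): composites of analytic functions are analytic; `exp`, `log` analytic — Mathlib
`AnalyticAt.rexp'`, `analyticAt_log`). [cite: Field2017, §5.4 Prop. 5.4.6] -/
theorem analyticAt_rpow_const_of_pos {f : ℝ → ℝ} {x : ℝ} (hf : AnalyticAt ℝ f x) (hpos : 0 < f x)
    (α : ℝ) : AnalyticAt ℝ (fun t => f t ^ α) x := by
  have hev : ∀ᶠ t in 𝓝 x, 0 < f t := hf.continuousAt.eventually_const_lt hpos
  have h : (fun t => Real.exp (Real.log (f t) * α)) =ᶠ[𝓝 x] fun t => f t ^ α := by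
    filter_upwards [hev] with t ht
    exact (Real.rpow_def_of_pos ht α).symm
  refine AnalyticAt.congr ?_ h
  have hlog : AnalyticAt ℝ (fun t => Real.log (f t)) x := (analyticAt_log hpos).comp hf
  exact (hlog.mul analyticAt_const).rexp'

end Literature.Analysis.Calculus
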